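import Literature.Computability.Complexity.SuccinctCircuitBitsMachine
import HarnessLib

/-!
# Succinct arithmetic circuits of polynomial depth, III: correctness of the bit evaluator and
# `bitLang K ∈ PSPACE`

Sequel of `SuccinctCircuitBits.lean` (the objects; §SchoolArith) and
`SuccinctCircuitBitsMachine.lean` (the evaluator `evalProc K : RecProc`, its step lemmas, its
certificate `cert`, and `mem_PSPACE_of_returns`). Here the SEMANTIC invariant of the evaluator's
activation records is spelled out program point by program point — partial column counts
`colCount`, partial convolution columns `convColUpTo`, rippled carries `carry`, bitwise agreement
of the two compared children — and shown to be preserved along the big-step semantics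
(`returns_frame_induct`); at the end of a column the register arithmetic is exactly the school
arithmetic of §SchoolArith (`testBit_sum_eq`, `testBit_mul_eq`), so the bit returned by the root
record of the query `⟨g, i⟩` is bit `i` of `val g`. With the certificate this gives the theorem of
the series:

* **`SuccCircuit.bitLang_mem_PSPACE`** — the bit language of an `FP`-succinct variable-free
  arithmetic circuit over `ℕ` of polynomial depth (constants by bit oracles, exponential fan-in
  sums, binary products, select-on-equality-of-low-bits) is in `PSPACE` (Koiran–Perifel, Prop. 1,
  direction `Uniform VPAR⁰ ⊆ Uniform VPSPACE⁰`, in the variable-free case, with uniformity =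
  polynomial time on gate names).

* `SInv` / `answer` — the semantic invariant and the intended answer of a record; `sinv_progress` —
  one step preserves them (continue), or calls a child whose true bit keeps them (call), or returns
  the intended answer (return); `returns_answer` — every `SInv` record returns its intended answer.

HONEST FRAMING (val-lit, KV20 M1 programme, brick (P2) layer G): generic infrastructure ("bits of
exponentially long numbers in polynomial space"); by itself it proves nothing about
`kumarVolk2020_cor_1_3`, whose remaining hypothesis is the instance (P6) of this theorem for the
canonical Kumar–Volk equation; `VP ≠ VNP` is NOT proved and nothing here bears on it.

## References

* P. Koiran, S. Perifel, *VPSPACE and a transfer theorem over the reals*, Comput. Complexity 18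
  (2009), §3.2, Prop. 1 and its proof [KoiranPerifel2009VPSPACE].
* D. E. Knuth, *TAOCP 2*, §4.3.1, Algorithms A and M [KnuthTAOCP2].
* S. Homer, A. L. Selman, *Computability and Complexity Theory*, Thm. 5.13 [HomerSelman2011].
-/

noncomputable section

namespace Literature.Computability.Complexity

open _root_.Computability Polynomial CodeFP Brick Finset

namespace SuccCircuit

variable (K : SuccCircuit)

/-! ### Bit bookkeeping -/

/-- A bit as a register value (`1`/`0`). [cite: KnuthTAOCP2, §4.1] -/
def bn (b : Bool) : ℕ := if b then 1 else 0

/-- `bn b = 1 ↔ b`. [cite: KnuthTAOCP2, §4.1] -/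
@[simp] theorem bn_eq_one_iff (b : Bool) : bn b = 1 ↔ b = true := by cases b <;> simp [bn]

/-- `bn true = 1`. [cite: KnuthTAOCP2, §4.1] -/
@[simp] theorem bn_true : bn true = 1 := rfl

/-- `bn false = 0`. [cite: KnuthTAOCP2, §4.1] -/
@[simp] theorem bn_false : bn false = 0 := rfl

/-- The resumed record stores `bn bit`. [cite: HomerSelman2011, Thm. 5.13 (proof, p. 97)] -/
theorem resumed_eq (ρ : Regs) (bit : Bool) :
    ρ.resumed bit = ⟨ρ.pc, ρ.i, ρ.kd, ρ.ar, ρ.wd, ρ.j, ρ.ix, ρ.col, ρ.cy, bn bit, 1, ρ.u, ρ.ans⟩ := rfl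

/-- **Agreement of low bits is congruence modulo a power of two.** [cite: KnuthTAOCP2, §4.1] -/
theorem mod_two_pow_eq_iff_testBit (x y W : ℕ) :
    x % 2 ^ W = y % 2 ^ W ↔ ∀ t, t < W → x.testBit t = y.testBit t := by
  constructor
  · intro h t ht
    have hx := Nat.testBit_mod_two_pow x W t
    have hy := Nat.testBit_mod_two_pow y W t
    rw [h] at hx
    rw [hx] at hy
    simpa [ht] using hy
  · intro h
    apply Nat.eq_of_testBit_eq
    intro t
    rw [Nat.testBit_mod_two_pow, Nat.testBit_mod_two_pow]
    by_cases ht : t < W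
    · simp [ht, h t ht]
    · simp [ht]

/-! ### The semantic invariant and the intended answer -/

section Semantics

variable (g : List Bool) (ρ : Regs)

/-- The cached header is correct. [cite: KoiranPerifel2009VPSPACE, §3.2, Prop. 1 (proof)] -/
def Hdr : Prop := ρ.kd = K.kind g ∧ ρ.ar = K.arity g ∧ ρ.wd = K.width g

/-- **The semantic invariant** of the evaluator's records, by program point (sum: partial column
count of column `j` over the summands `< ix`, carry into column `j`; product: partial convolution
column, carry; select: agreement of the compared children below bit `j`; pending returns hold the
true bit of the child just asked). [cite: KnuthTAOCP2, §4.3.1, Algorithms A, M] [cite: KoiranPerifel2009VPSPACE, §3.2, Prop. 1 (proof)] -/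
def SInv : Prop :=
  if ρ.pc = 0 then ρ.kd = 0 ∧ ρ.ar = 0 ∧ ρ.wd = 0 ∧ ρ.j = 0 ∧ ρ.ix = 0 ∧ ρ.col = 0 ∧ ρ.cy = 0 ∧ ρ.b = 0 ∧
    ρ.fl = 0 ∧ ρ.u = 0 ∧ ρ.ans = 0
  else if ρ.pc = 1 then K.Hdr g ρ ∧ ρ.fl = 0
  else if ρ.pc = 2 then ρ.fl = 0
  else if ρ.pc = 13 then ρ.fl = 0
  else if ρ.pc = 10 then K.Hdr g ρ ∧ ρ.fl = 0 ∧ K.kind g = 1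
  else if ρ.pc = 11 then K.Hdr g ρ ∧ K.kind g = 1 ∧ ρ.j ≤ ρ.i ∧ ρ.ix ≤ K.arity g ∧
    ρ.col = colCount (fun k => K.val (K.child g k)) ρ.ix ρ.j ∧ ρ.cy = carry (colCount (fun k => K.val (K.child g k)) (K.arity g)) ρ.j ∧
    (ρ.fl = 0 ∨ (ρ.fl = 1 ∧ ρ.ix < K.arity g ∧ ρ.b = bn ((K.val (K.child g ρ.ix)).testBit ρ.j)))
  else if ρ.pc = 12 then K.Hdr g ρ ∧ K.kind g = 1 ∧ ρ.j ≤ ρ.i ∧ ρ.fl = 0 ∧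
    ρ.col = colCount (fun k => K.val (K.child g k)) (K.arity g) ρ.j ∧
    ρ.cy = carry (colCount (fun k => K.val (K.child g k)) (K.arity g)) ρ.j
  else if ρ.pc = 20 then K.Hdr g ρ ∧ ρ.fl = 0 ∧ K.kind g = 2
  else if ρ.pc = 21 then K.Hdr g ρ ∧ K.kind g = 2 ∧ ρ.j ≤ ρ.i ∧ ρ.ix ≤ ρ.j + 1 ∧
    ρ.col = convColUpTo (K.val (K.child g 0)) (K.val (K.child g 1)) ρ.j ρ.ix ∧
    ρ.cy = carry (convCol (K.val (K.child g 0)) (K.val (K.child g 1))) ρ.j ∧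
    (ρ.fl = 0 ∨ (ρ.fl = 1 ∧ ρ.ix ≤ ρ.j ∧ ρ.b = bn ((K.val (K.child g 0)).testBit ρ.ix)))
  else if ρ.pc = 22 then K.Hdr g ρ ∧ K.kind g = 2 ∧ ρ.j ≤ ρ.i ∧ ρ.ix ≤ ρ.j ∧
    ρ.col = convColUpTo (K.val (K.child g 0)) (K.val (K.child g 1)) ρ.j ρ.ix ∧
    ρ.cy = carry (convCol (K.val (K.child g 0)) (K.val (K.child g 1))) ρ.j ∧
    ρ.u = bn ((K.val (K.child g 0)).testBit ρ.ix) ∧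
    (ρ.fl = 0 ∨ (ρ.fl = 1 ∧ ρ.u = 1 ∧ ρ.b = bn ((K.val (K.child g 1)).testBit (ρ.j - ρ.ix))))
  else if ρ.pc = 24 then K.Hdr g ρ ∧ K.kind g = 2 ∧ ρ.j ≤ ρ.i ∧ ρ.fl = 0 ∧
    ρ.col = convCol (K.val (K.child g 0)) (K.val (K.child g 1)) ρ.j ∧
    ρ.cy = carry (convCol (K.val (K.child g 0)) (K.val (K.child g 1))) ρ.j
  else if ρ.pc = 30 then K.Hdr g ρ ∧ ρ.fl = 0 ∧ K.kind g = 3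
  else if ρ.pc = 31 then K.Hdr g ρ ∧ K.kind g = 3 ∧ ρ.j ≤ K.width g ∧
    (∀ t, t < ρ.j → (K.val (K.child g 0)).testBit t = (K.val (K.child g 1)).testBit t) ∧
    (ρ.fl = 0 ∨ (ρ.fl = 1 ∧ ρ.j < K.width g ∧ ρ.b = bn ((K.val (K.child g 0)).testBit ρ.j)))
  else if ρ.pc = 32 then K.Hdr g ρ ∧ K.kind g = 3 ∧ ρ.j < K.width g ∧
    (∀ t, t < ρ.j → (K.val (K.child g 0)).testBit t = (K.val (K.child g 1)).testBit t) ∧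
    ρ.u = bn ((K.val (K.child g 0)).testBit ρ.j) ∧
    (ρ.fl = 0 ∨ (ρ.fl = 1 ∧ ρ.b = bn ((K.val (K.child g 1)).testBit ρ.j)))
  else if ρ.pc = 35 then K.kind g = 3 ∧
    K.val (K.child g 0) % 2 ^ K.width g = K.val (K.child g 1) % 2 ^ K.width g ∧
    (ρ.fl = 0 ∨ (ρ.fl = 1 ∧ ρ.b = bn ((K.val (K.child g 2)).testBit ρ.i)))
  else if ρ.pc = 36 then K.kind g = 3 ∧
    K.val (K.child g 0) % 2 ^ K.width g ≠ K.val (K.child g 1) % 2 ^ K.width g ∧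
    (ρ.fl = 0 ∨ (ρ.fl = 1 ∧ ρ.b = bn ((K.val (K.child g 3)).testBit ρ.i)))
  else False

/-- **The intended answer** of a record: at `13` the answer register, at `2` the constant's bit, at
`35`/`36` with a pending return the returned bit, otherwise bit `i` of the value of the gate. [cite: KoiranPerifel2009VPSPACE, §3.2, Prop. 1 (proof)] -/
def answer : Bool :=
  if ρ.pc = 13 then decide (ρ.ans = 1)
  else if ρ.pc = 2 then K.constBit g ρ.i
  else if (ρ.pc = 35 ∨ ρ.pc = 36) ∧ ρ.fl = 1 then decide (ρ.b = 1)
  else (K.val g).testBit ρ.i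

end Semantics

/-! ### One step preserves the semantic invariant and the intended answer -/

section Progress

variable {K}
variable {g : List Bool} {ρ : Regs}

/-- The program points of a record satisfying the semantic invariant. [cite: HomerSelman2011, Thm. 5.13 (proof, p. 97)] -/
private theorem spc_cases (h : K.SInv g ρ) :
    ρ.pc = 0 ∨ ρ.pc = 1 ∨ ρ.pc = 2 ∨ ρ.pc = 13 ∨ ρ.pc = 10 ∨ ρ.pc = 11 ∨ ρ.pc = 12 ∨ ρ.pc = 20 ∨ ρ.pc = 21 ∨
      ρ.pc = 22 ∨ ρ.pc = 24 ∨ ρ.pc = 30 ∨ ρ.pc = 31 ∨ ρ.pc = 32 ∨ ρ.pc = 35 ∨ ρ.pc = 36 := by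
  by_contra hne
  simp only [not_or] at hne
  obtain ⟨h0, h1, h2, h13, h10, h11, h12, h20, h21, h22, h24, h30, h31, h32, h35, h36⟩ := hne
  simp only [SInv, h0, h1, h2, h13, h10, h11, h12, h20, h21, h22, h24, h30, h31, h32, h35, h36, if_false] at h

variable (K g ρ)

/-- **What one step does to the semantic invariant**: CONTINUE to a record with the invariant and
the same intended answer; CALL a child on a bit such that the record resumed with the TRUE bit has
the invariant and the same intended answer; RETURN the intended answer. [cite: KoiranPerifel2009VPSPACE, §3.2, Prop. 1 (proof)] [cite: KnuthTAOCP2, §4.3.1, Algorithms A, M] -/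
def SemProgress : Prop :=
  (∃ ρ' : Regs, K.stepSem (g, ρ.toList) = .cont (g, ρ'.toList) ∧ K.SInv g ρ' ∧ K.answer g ρ' = K.answer g ρ) ∨
    (∃ k t, K.stepSem (g, ρ.toList) = .call (K.child g k, initRegs t) ∧
      K.SInv g (ρ.resumed ((K.val (K.child g k)).testBit t)) ∧
      K.answer g (ρ.resumed ((K.val (K.child g k)).testBit t)) = K.answer g ρ) ∨
    K.stepSem (g, ρ.toList) = .ret [K.answer g ρ]

variable {K g ρ}

/-- Semantic progress at `0`, `1`, `2`, `13`. [cite: KoiranPerifel2009VPSPACE, §3.2, Prop. 1 (proof: dispatch; "input gates")] -/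
private theorem sprog_head (h : K.SInv g ρ) (hpc : ρ.pc = 0 ∨ ρ.pc = 1 ∨ ρ.pc = 2 ∨ ρ.pc = 13) : K.SemProgress g ρ := by
  rcases hpc with hpc | hpc | hpc | hpc <;> (simp only [SInv, hpc] at h; norm_num at h)
  · -- 0 → 1
    refine Or.inl ⟨_, K.stepSem_pc0 g ρ (by omega) hpc, ?_, ?_⟩
    · norm_num [SInv, Hdr]
    · norm_num [answer, hpc]
  · -- 1 → dispatch
    obtain ⟨⟨hkd, har, hwd⟩, hf⟩ := h
    refine Or.inl ⟨_, K.stepSem_pc1 g ρ (by omega) hpc, ?_, ?_⟩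
    · by_cases k1 : K.kind g = 1
      · norm_num [SInv, Hdr, hkd, har, hwd, k1, hf]
      · by_cases k2 : K.kind g = 2
        · norm_num [SInv, Hdr, hkd, har, hwd, k2, hf]
        · by_cases k3 : K.kind g = 3
          · norm_num [SInv, Hdr, hkd, har, hwd, k3, hf]
          · norm_num [SInv, Hdr, hkd, k1, k2, k3, hf]
    · by_cases k1 : K.kind g = 1
      · norm_num [answer, hkd, k1, hpc]
      · by_cases k2 : K.kind g = 2
        · norm_num [answer, hkd, k2, hpc]
        · by_cases k3 : K.kind g = 3
          · norm_num [answer, hkd, k3, hpc]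
          · -- a constant gate: its bit oracle answers
            norm_num [answer, hkd, k1, k2, k3, hpc, constBit]
            rw [K.val_const k1 k2 k3, K.testBit_cval]
  · -- 2: return the constant's bit
    refine Or.inr (Or.inr ?_)
    rw [K.stepSem_pc2 g ρ (by omega) hpc]
    norm_num [answer, hpc]
  · -- 13: return the answer
    refine Or.inr (Or.inr ?_)
    rw [K.stepSem_pc13 g ρ (by omega) hpc]
    norm_num [answer, hpc]

/-- Semantic progress at the loop heads `10`, `20`, `30`. [cite: KnuthTAOCP2, §4.3.1, Algorithms A (A1), M (M1)] -/
private theorem sprog_loopHead (h : K.SInv g ρ) (hpc : ρ.pc = 10 ∨ ρ.pc = 20 ∨ ρ.pc = 30) : K.SemProgress g ρ := by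
  rcases hpc with hpc | hpc | hpc <;> (simp only [SInv, hpc] at h; norm_num at h) <;>
    obtain ⟨⟨hkd, har, hwd⟩, hf, hk⟩ := h
  · refine Or.inl ⟨_, K.stepSem_pc10 g ρ (by omega) hpc, ?_, ?_⟩
    · norm_num [SInv, Hdr, hkd, har, hwd, hk, hf, colCount, carry]
    · norm_num [answer, hpc, hf]
  · refine Or.inl ⟨_, K.stepSem_pc20 g ρ (by omega) hpc, ?_, ?_⟩
    · norm_num [SInv, Hdr, hkd, har, hwd, hk, hf, convColUpTo, carry]
    · norm_num [answer, hpc, hf]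
  · refine Or.inl ⟨_, K.stepSem_pc30 g ρ (by omega) hpc, ?_, ?_⟩
    · norm_num [SInv, Hdr, hkd, har, hwd, hk, hf]
    · norm_num [answer, hpc, hf]

/-- Semantic progress at `11` (sum, inside a column): ask summand `ix` for its bit `j` and add it
to the column count; when the column is complete, its count is the full column count. [cite: KnuthTAOCP2, §4.3.1, Algorithm A (A2)] [cite: VollmerCircuitComplexity1999, Thm. 1.20] -/
private theorem sprog11 (h : K.SInv g ρ) (hpc : ρ.pc = 11) : K.SemProgress g ρ := by
  simp only [SInv, hpc] at h; norm_num at h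
  obtain ⟨⟨hkd, har, hwd⟩, k1, hji, hixA, hcol, hcy, hfl⟩ := h
  rcases hfl with hf | ⟨hf, hlt, hb⟩
  · by_cases hlt : ρ.ix < ρ.ar
    · -- call summand `ix`
      refine Or.inr (Or.inl ⟨ρ.ix, ρ.j, K.stepSem_pc11_call g ρ (by omega) hpc hlt, ?_, ?_⟩)
      · rw [har] at hlt
        norm_num [SInv, resumed_eq, hpc, Hdr, hkd, har, hwd, k1, hji, hixA, hcol, hcy, hlt]
      · norm_num [answer, resumed_eq, hpc]
    · -- column complete
      have hix : ρ.ix = K.arity g := by rw [har] at hlt; omega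
      refine Or.inl ⟨_, K.stepSem_pc11_done g ρ (by omega) hpc hlt, ?_, ?_⟩
      · rw [hix] at hcol
        norm_num [SInv, Hdr, hkd, har, hwd, k1, hf, hji, hcol, hcy]
      · norm_num [answer, hpc, hf]
  · -- absorb the summand's bit
    refine Or.inl ⟨_, K.stepSem_post11 g ρ hf hpc, ?_, ?_⟩
    · have hcol' : ρ.col + ρ.b = colCount (fun k => K.val (K.child g k)) (ρ.ix + 1) ρ.j := by
        rw [colCount_succ, hcol, hb, bn]
      norm_num [SInv, Hdr, hkd, har, hwd, k1, hji, hcol', hcy]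
      omega
    · norm_num [answer, hpc, hf]

/-- Semantic progress at `12` (sum, end of column `j`): the answer `(col + carry) mod 2` IS bit `i`
of the sum (`testBit_sum_eq`, `val_sum`); else ripple the carry. [cite: KnuthTAOCP2, §4.3.1, Algorithm A (A2–A3)] -/
private theorem sprog12 (h : K.SInv g ρ) (hpc : ρ.pc = 12) : K.SemProgress g ρ := by
  simp only [SInv, hpc] at h; norm_num at h
  obtain ⟨⟨hkd, har, hwd⟩, k1, hji, hf, hcol, hcy⟩ := h
  by_cases hlast : ρ.j = ρ.i
  · refine Or.inl ⟨_, K.stepSem_pc12_24_last g ρ (by omega) (Or.inl hpc) hlast, ?_, ?_⟩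
    · norm_num [SInv, hf]
    · norm_num [answer, hpc, hf]
      rw [K.val_sum k1, testBit_sum_eq, hcol, hcy, hlast]
  · refine Or.inl ⟨_, K.stepSem_pc12_next g ρ (by omega) hpc hlast, ?_, ?_⟩
    · have hcy' : (ρ.col + ρ.cy) / 2 = carry (colCount (fun k => K.val (K.child g k)) (K.arity g)) (ρ.j + 1) := by
        rw [hcol, hcy]; rfl
      norm_num [SInv, Hdr, hkd, har, hwd, k1, hf, hcy', colCount]
      omega
    · norm_num [answer, hpc, hf]

/-- Semantic progress at `21` (product, inside a column): ask the first factor's bit `a`; when the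
column is complete, it is the convolution column. [cite: KnuthTAOCP2, §4.3.1, Algorithm M (M3)] -/
private theorem sprog21 (h : K.SInv g ρ) (hpc : ρ.pc = 21) : K.SemProgress g ρ := by
  simp only [SInv, hpc] at h; norm_num at h
  obtain ⟨⟨hkd, har, hwd⟩, k2, hji, hixj, hcol, hcy, hfl⟩ := h
  rcases hfl with hf | ⟨hf, hle, hb⟩
  · by_cases hle : ρ.ix ≤ ρ.j
    · refine Or.inr (Or.inl ⟨0, ρ.ix, K.stepSem_pc21_call g ρ (by omega) hpc hle, ?_, ?_⟩)
      · norm_num [SInv, resumed_eq, hpc, Hdr, hkd, har, hwd, k2, hji, hixj, hcol, hcy, hle]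
      · norm_num [answer, resumed_eq, hpc]
    · have hix : ρ.ix = ρ.j + 1 := by omega
      refine Or.inl ⟨_, K.stepSem_pc21_done g ρ (by omega) hpc hle, ?_, ?_⟩
      · rw [hix, convColUpTo_self] at hcol
        norm_num [SInv, Hdr, hkd, har, hwd, k2, hf, hji, hcol, hcy]
      · norm_num [answer, hpc, hf]
  · refine Or.inl ⟨_, K.stepSem_post21 g ρ hf hpc, ?_, ?_⟩
    · norm_num [SInv, Hdr, hkd, har, hwd, k2, hji, hle, hcol, hcy, hb]
    · norm_num [answer, hpc, hf]

/-- Semantic progress at `22` (product, second factor): if the first factor's bit is `1`, ask the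
second factor's bit `j − a` and add it; else the term vanishes. [cite: KnuthTAOCP2, §4.3.1, Algorithm M (M4)] -/
private theorem sprog22 (h : K.SInv g ρ) (hpc : ρ.pc = 22) : K.SemProgress g ρ := by
  simp only [SInv, hpc] at h; norm_num at h
  obtain ⟨⟨hkd, har, hwd⟩, k2, hji, hixj, hcol, hcy, hu, hfl⟩ := h
  rcases hfl with hf | ⟨hf, hu1, hb⟩
  · by_cases hu1 : ρ.u = 1
    · refine Or.inr (Or.inl ⟨1, ρ.j - ρ.ix, K.stepSem_pc22_call g ρ (by omega) hpc hu1, ?_, ?_⟩)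
      · norm_num [SInv, resumed_eq, hpc, Hdr, hkd, har, hwd, k2, hji, hixj, hcol, hcy, hu1]
        rw [hu] at hu1; exact hu1.symm
      · norm_num [answer, resumed_eq, hpc]
    · -- the first factor's bit is `0`: the term vanishes
      have hx0 : (K.val (K.child g 0)).testBit ρ.ix = false := by
        rw [hu] at hu1; simpa using hu1
      have hcol' : ρ.col = convColUpTo (K.val (K.child g 0)) (K.val (K.child g 1)) ρ.j (ρ.ix + 1) := by
        rw [convColUpTo_succ, hcol, hx0]; simp
      refine Or.inl ⟨_, K.stepSem_pc22_skip g ρ (by omega) hpc hu1, ?_, ?_⟩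
      · norm_num [SInv, Hdr, hkd, har, hwd, k2, hf, hji, hcol', hcy]
        omega
      · norm_num [answer, hpc, hf]
  · have hx1 : (K.val (K.child g 0)).testBit ρ.ix = true := by rw [hu] at hu1; simpa using hu1
    have hcol' : ρ.col + ρ.b = convColUpTo (K.val (K.child g 0)) (K.val (K.child g 1)) ρ.j (ρ.ix + 1) := by
      rw [convColUpTo_succ, hcol, hb, hx1, bn]; simp
    refine Or.inl ⟨_, K.stepSem_post22 g ρ hf hpc, ?_, ?_⟩
    · norm_num [SInv, Hdr, hkd, har, hwd, k2, hji, hcol', hcy]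
      omega
    · norm_num [answer, hpc, hf]

/-- Semantic progress at `24` (product, end of column `j`): `(col + carry) mod 2` IS bit `i` of the
product (`testBit_mul_eq`, `val_mul`); else ripple the carry. [cite: KnuthTAOCP2, §4.3.1, Algorithm M (M5–M6)] -/
private theorem sprog24 (h : K.SInv g ρ) (hpc : ρ.pc = 24) : K.SemProgress g ρ := by
  simp only [SInv, hpc] at h; norm_num at h
  obtain ⟨⟨hkd, har, hwd⟩, k2, hji, hf, hcol, hcy⟩ := h
  by_cases hlast : ρ.j = ρ.i
  · refine Or.inl ⟨_, K.stepSem_pc12_24_last g ρ (by omega) (Or.inr hpc) hlast, ?_, ?_⟩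
    · norm_num [SInv, hf]
    · norm_num [answer, hpc, hf]
      rw [K.val_mul k2, testBit_mul_eq, hcol, hcy, hlast]
  · refine Or.inl ⟨_, K.stepSem_pc24_next g ρ (by omega) hpc hlast, ?_, ?_⟩
    · have hcy' : (ρ.col + ρ.cy) / 2 = carry (convCol (K.val (K.child g 0)) (K.val (K.child g 1))) (ρ.j + 1) := by
        rw [hcol, hcy]; rfl
      norm_num [SInv, Hdr, hkd, har, hwd, k2, hf, hcy', convColUpTo]
      omega
    · norm_num [answer, hpc, hf]

/-- Semantic progress at `31` (select, comparing bit `j` of the first two children): all `width`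
low bits agree ⇒ congruent (`mod_two_pow_eq_iff_testBit`), to the tail call of child `2`. [cite: KoiranPerifel2009VPSPACE, §3.2] -/
private theorem sprog31 (h : K.SInv g ρ) (hpc : ρ.pc = 31) : K.SemProgress g ρ := by
  simp only [SInv, hpc] at h; norm_num at h
  obtain ⟨⟨hkd, har, hwd⟩, k3, hjW, hagree, hfl⟩ := h
  rcases hfl with hf | ⟨hf, hlt, hb⟩
  · by_cases hlt : ρ.j < ρ.wd
    · refine Or.inr (Or.inl ⟨0, ρ.j, K.stepSem_pc31_call g ρ (by omega) hpc hlt, ?_, ?_⟩)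
      · rw [hwd] at hlt
        norm_num [SInv, resumed_eq, hpc, Hdr, hkd, har, hwd, k3, hjW, hlt]
        exact hagree
      · norm_num [answer, resumed_eq, hpc]
    · have hj : ρ.j = K.width g := by rw [hwd] at hlt; omega
      have hmod : K.val (K.child g 0) % 2 ^ K.width g = K.val (K.child g 1) % 2 ^ K.width g :=
        (mod_two_pow_eq_iff_testBit _ _ _).2 (hj ▸ hagree)
      refine Or.inl ⟨_, K.stepSem_pc31_done g ρ (by omega) hpc hlt, ?_, ?_⟩
      · norm_num [SInv, k3, hf, hmod]
      · norm_num [answer, hpc, hf]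
  · refine Or.inl ⟨_, K.stepSem_post31 g ρ hf hpc, ?_, ?_⟩
    · norm_num [SInv, Hdr, hkd, har, hwd, k3, hlt, hb]
      exact hagree
    · norm_num [answer, hpc, hf]

/-- Semantic progress at `32` (select, bit `j` of the second child): equal bits extend the
agreement; a differing bit below `width` refutes the congruence. [cite: KoiranPerifel2009VPSPACE, §3.2] -/
private theorem sprog32 (h : K.SInv g ρ) (hpc : ρ.pc = 32) : K.SemProgress g ρ := by
  simp only [SInv, hpc] at h; norm_num at h
  obtain ⟨⟨hkd, har, hwd⟩, k3, hjW, hagree, hu, hfl⟩ := h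
  rcases hfl with hf | ⟨hf, hb⟩
  · refine Or.inr (Or.inl ⟨1, ρ.j, K.stepSem_pc32 g ρ (by omega) hpc, ?_, ?_⟩)
    · norm_num [SInv, resumed_eq, hpc, Hdr, hkd, har, hwd, k3, hjW, hu]
      exact hagree
    · norm_num [answer, resumed_eq, hpc]
  · by_cases hbu : ρ.b = ρ.u
    · -- equal bits: agreement below `j + 1`
      have hbit : (K.val (K.child g 0)).testBit ρ.j = (K.val (K.child g 1)).testBit ρ.j := by
        rw [hb, hu] at hbu
        revert hbu
        cases (K.val (K.child g 0)).testBit ρ.j <;> cases (K.val (K.child g 1)).testBit ρ.j <;> simp [bn]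
      have hagree' : ∀ t, t ≤ ρ.j → (K.val (K.child g 0)).testBit t = (K.val (K.child g 1)).testBit t := by
        intro t ht
        by_cases ht' : t < ρ.j
        · exact hagree t ht'
        · have : t = ρ.j := by omega
          subst this; exact hbit
      refine Or.inl ⟨⟨31, ρ.i, ρ.kd, ρ.ar, ρ.wd, ρ.j + 1, ρ.ix, ρ.col, ρ.cy, ρ.b, 0, ρ.u, ρ.ans⟩, ?_, ?_, ?_⟩
      · rw [K.stepSem_post32 g ρ hf hpc]; simp only [hbu, if_true]
      · norm_num [SInv, Hdr, hkd, har, hwd, k3]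
        exact ⟨by omega, hagree'⟩
      · norm_num [answer, hpc, hf]
    · -- a differing bit below `width`
      have hbit : (K.val (K.child g 0)).testBit ρ.j ≠ (K.val (K.child g 1)).testBit ρ.j := by
        rw [hb, hu] at hbu
        revert hbu
        cases (K.val (K.child g 0)).testBit ρ.j <;> cases (K.val (K.child g 1)).testBit ρ.j <;> simp [bn]
      have hmod : K.val (K.child g 0) % 2 ^ K.width g ≠ K.val (K.child g 1) % 2 ^ K.width g :=
        fun heq => hbit (((mod_two_pow_eq_iff_testBit _ _ _).1 heq) ρ.j hjW)
      refine Or.inl ⟨⟨36, ρ.i, ρ.kd, ρ.ar, ρ.wd, ρ.j, ρ.ix, ρ.col, ρ.cy, ρ.b, 0, ρ.u, ρ.ans⟩, ?_, ?_, ?_⟩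
      · rw [K.stepSem_post32 g ρ hf hpc]; simp only [hbu, if_false]
      · norm_num [SInv, k3]
        exact hmod
      · norm_num [answer, hpc, hf]

/-- Semantic progress at `35` / `36` (select, tail calls): the selected child's bit `i` is bit `i` of
the gate (`val_mux`). [cite: KoiranPerifel2009VPSPACE, §3.2] -/
private theorem sprog35_36 (h : K.SInv g ρ) (hpc : ρ.pc = 35 ∨ ρ.pc = 36) : K.SemProgress g ρ := by
  rcases hpc with hpc | hpc <;> (simp only [SInv, hpc] at h; norm_num at h) <;> obtain ⟨k3, hmod, hfl⟩ := h
  · rcases hfl with hf | ⟨hf, hb⟩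
    · refine Or.inr (Or.inl ⟨2, ρ.i, K.stepSem_pc35 g ρ (by omega) hpc, ?_, ?_⟩)
      · norm_num [SInv, resumed_eq, hpc, k3, hmod]
      · have hv : K.val g = K.val (K.child g 2) := by rw [K.val_mux k3, if_pos hmod]
        norm_num [answer, resumed_eq, hpc, hf, hv]
    · refine Or.inl ⟨_, K.stepSem_post35_36 g ρ hf (Or.inl hpc), ?_, ?_⟩
      · norm_num [SInv]
      · norm_num [answer, hpc, hf]
  · rcases hfl with hf | ⟨hf, hb⟩
    · refine Or.inr (Or.inl ⟨3, ρ.i, K.stepSem_pc36 g ρ (by omega) hpc, ?_, ?_⟩)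
      · norm_num [SInv, resumed_eq, hpc, k3]
        exact hmod
      · have hv : K.val g = K.val (K.child g 3) := by rw [K.val_mux k3, if_neg hmod]
        norm_num [answer, resumed_eq, hpc, hf, hv]
    · refine Or.inl ⟨_, K.stepSem_post35_36 g ρ hf (Or.inr hpc), ?_, ?_⟩
      · norm_num [SInv]
      · norm_num [answer, hpc, hf]

/-- **Semantic progress.** [cite: KoiranPerifel2009VPSPACE, §3.2, Prop. 1 (proof)] [cite: KnuthTAOCP2, §4.3.1, Algorithms A, M] -/
theorem sinv_progress (h : K.SInv g ρ) : K.SemProgress g ρ := by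
  rcases spc_cases h with hp | hp | hp | hp | hp | hp | hp | hp | hp | hp | hp | hp | hp | hp | hp | hp
  · exact sprog_head h (Or.inl hp)
  · exact sprog_head h (Or.inr (Or.inl hp))
  · exact sprog_head h (Or.inr (Or.inr (Or.inl hp)))
  · exact sprog_head h (Or.inr (Or.inr (Or.inr hp)))
  · exact sprog_loopHead h (Or.inl hp)
  · exact sprog11 h hp
  · exact sprog12 h hp
  · exact sprog_loopHead h (Or.inr (Or.inl hp))
  · exact sprog21 h hp
  · exact sprog22 h hp
  · exact sprog24 h hp
  · exact sprog_loopHead h (Or.inr (Or.inr hp))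
  · exact sprog31 h hp
  · exact sprog32 h hp
  · exact sprog35_36 h (Or.inl hp)
  · exact sprog35_36 h (Or.inr hp)

end Progress

/-! ### Correctness and the `PSPACE` theorem -/

/-- A fresh call's record satisfies the semantic invariant, with intended answer bit `t` of the gate. [cite: KoiranPerifel2009VPSPACE, §3.2, Prop. 1 (proof)] -/
theorem sinv_init (g : List Bool) (t : ℕ) :
    K.SInv g ⟨0, t, 0, 0, 0, 0, 0, 0, 0, 0, 0, 0, 0⟩ ∧ K.answer g ⟨0, t, 0, 0, 0, 0, 0, 0, 0, 0, 0, 0, 0⟩ = (K.val g).testBit t := by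
  constructor
  · norm_num [SInv]
  · norm_num [answer]

/-- **Correctness of the evaluator**: a record satisfying the semantic invariant returns (the
one-bit string of) its intended answer. [cite: KoiranPerifel2009VPSPACE, §3.2, Prop. 1 (proof)] [cite: HomerSelman2011, Thm. 5.13 (proof, p. 97)] -/
theorem returns_answer {g : List Bool} {ρ : Regs} {v : List Bool} (hv : K.evalProc.Returns (frameE (g, ρ.toList)) v)
    (h : K.SInv g ρ) : v = [K.answer g ρ] := by
  have key := K.returns_frame_induct (I := fun x => ∃ ρ : Regs, x.2 = ρ.toList ∧ K.SInv x.1 ρ)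
    (Q := fun x v => ∀ ρ : Regs, x.2 = ρ.toList → v = [K.answer x.1 ρ]) ?_ ?_ ?_ ?_ ?_ hv ⟨ρ, rfl, h⟩
  · exact key ρ rfl
  · -- RETURN steps return the intended answer
    rintro ⟨g', r⟩ v ⟨ρ', hr, hI⟩ hs ρ'' hr''
    simp only at hr hI hr'' ⊢
    subst hr
    obtain rfl := Regs.toList_injective hr''
    rcases K.sinv_progress hI with ⟨ρ₁, hs₁, -, -⟩ | ⟨k, t, hs₁, -, -⟩ | hs₁
    · rw [hs₁] at hs; exact absurd hs (by simp)
    · rw [hs₁] at hs; exact absurd hs (by simp)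
    · rw [hs₁] at hs; simpa using hs.symm
  · -- CONTINUE keeps the invariant
    rintro ⟨g', r⟩ x' ⟨ρ', hr, hI⟩ hs
    simp only at hr hI
    subst hr
    rcases K.sinv_progress hI with ⟨ρ₁, hs₁, hI₁, -⟩ | ⟨k, t, hs₁, -, -⟩ | hs₁
    · rw [hs₁] at hs
      obtain rfl := Act.cont.inj hs
      exact ⟨ρ₁, rfl, hI₁⟩
    · rw [hs₁] at hs; exact absurd hs (by simp)
    · rw [hs₁] at hs; exact absurd hs (by simp)
  · -- CONTINUE keeps the intended answer
    rintro ⟨g', r⟩ x' v ⟨ρ', hr, hI⟩ hs hQ ρ'' hr''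
    simp only at hr hI hr'' ⊢
    subst hr
    obtain rfl := Regs.toList_injective hr''
    rcases K.sinv_progress hI with ⟨ρ₁, hs₁, -, ha₁⟩ | ⟨k, t, hs₁, -, -⟩ | hs₁
    · rw [hs₁] at hs
      obtain rfl := Act.cont.inj hs
      rw [hQ ρ₁ rfl, ha₁]
    · rw [hs₁] at hs; exact absurd hs (by simp)
    · rw [hs₁] at hs; exact absurd hs (by simp)
  · -- CALL pushes a fresh call, which has the invariant
    rintro ⟨g', r⟩ y ⟨ρ', hr, hI⟩ hs
    simp only at hr hI
    subst hr
    rcases K.sinv_progress hI with ⟨ρ₁, hs₁, -, -⟩ | ⟨k, t, hs₁, -, -⟩ | hs₁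
    · rw [hs₁] at hs; exact absurd hs (by simp)
    · rw [hs₁] at hs
      obtain rfl := Act.call.inj hs
      exact ⟨⟨0, t, 0, 0, 0, 0, 0, 0, 0, 0, 0, 0, 0⟩, rfl, (K.sinv_init _ t).1⟩
    · rw [hs₁] at hs; exact absurd hs (by simp)
  · -- the resumed caller: the callee returned the TRUE bit
    rintro ⟨g', r⟩ y u ⟨ρ', hr, hI⟩ hs hQ
    simp only at hr hI ⊢
    subst hr
    rcases K.sinv_progress hI with ⟨ρ₁, hs₁, -, -⟩ | ⟨k, t, hs₁, hI₁, ha₁⟩ | hs₁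
    · rw [hs₁] at hs; exact absurd hs (by simp)
    · rw [hs₁] at hs
      obtain rfl := Act.call.inj hs
      have hu : u = [(K.val (K.child g' k)).testBit t] := by
        rw [hQ ⟨0, t, 0, 0, 0, 0, 0, 0, 0, 0, 0, 0, 0⟩ rfl, (K.sinv_init _ t).2]
      have hbit : u.getD 0 false = (K.val (K.child g' k)).testBit t := by rw [hu]; rfl
      rw [resumeSem_toList, hbit]
      refine ⟨⟨_, rfl, hI₁⟩, fun v hv ρ'' hr'' => ?_⟩
      obtain rfl := Regs.toList_injective hr''
      rw [hv _ rfl, ha₁]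
    · rw [hs₁] at hs; exact absurd hs (by simp)

/-- **The root record of the query `⟨g, i⟩` returns bit `i` of `val g`.** [cite: KoiranPerifel2009VPSPACE, §3.2, Prop. 1] -/
theorem returns_root (w : List Bool) (v : List Bool) (hv : K.evalProc.Returns (K.evalProc.init w) v) :
    v = [(K.val (fstF w)).testBit (bitsToNat (sndF w))] := by
  rw [K.init_eq_frameE] at hv
  rw [K.returns_answer hv (K.sinv_init _ _).1, (K.sinv_init _ _).2]

/-- **Theorem (bits of succinct poly-depth circuits in polynomial space).** The bit language of an
`FP`-succinct variable-free arithmetic circuit over `ℕ` of polynomial depth — constants by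
polynomial-time bit oracles, sums of exponential fan-in, binary products, select-on-equality of
low bits — is in `PSPACE`. [cite: KoiranPerifel2009VPSPACE, §3.2, Prop. 1 (Uniform VPAR⁰ ⊆ Uniform VPSPACE⁰; proof: "we compute the coefficient … for each gate … For a +-gate … add … For a gate a × b … the sum of the cd")] [cite: HomerSelman2011, Thm. 5.13] -/
theorem bitLang_mem_PSPACE : K.bitLang ∈ PSPACE := by
  refine K.mem_PSPACE_of_returns fun w v hv => ?_
  rw [K.returns_root w v hv]
  rfl

end SuccCircuit

end Literature.Computability.Complexity
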